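import Summits.FinalStateConjecture.FinalStateConjecture.Theorems.StarvedNecksNecksCertifyStubSeamSurgeryMain
import Summits.FinalStateConjecture.FinalStateConjecture.Theorems.StarvedNecksNecksCertifyStubSeamClockRadii
import Summits.FinalStateConjecture.FinalStateConjecture.Theorems.StarvedNecksNecksCertifyStubSeamFlatRestrict

/-!
# Route StarvedNecks — crux `GapDecaySuffices` (stmt-FinalStateConjecture-18060), line `Sketch`: stub `stub_seamSurgeryPos`

`stub_seamSurgeryPos : SeamSurgeryPos` — the SEAM SURGERY FOR `0 < d.N` WITH `Hf`(2) ONLY of the line skeleton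
`Cruxes/GapDecaySuffices/Lines/Sketch.lean`, stated with the skeleton's bundles `HonestCore`, `Seamed`, `NeckAtlas`
inlined verbatim as `let`s, its `FlatTubesClosed` clause written out, and the statement itself bound as a final
`let SeamSurgeryPos` so that the header ends in the registered text (a Theorems file cannot import the Cruxes
workfile; the lead closes the skeleton stub by `exact stub_seamSurgeryPos`, `let`/δ-unfolding being definitional).

PROOF.  This is the `0 < d.N` branch of the landed N2 `…Theorems.NecksCertifyTwoCap.Seam.stub_seamSurgery`
(`StarvedNecksNecksCertifyStubSeamSurgeryMain.lean`), copied mechanically: that proof destructs `Hc` as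
`⟨hc1, hc2, -, hc4⟩` and `Hf` as `⟨-, hf2, -⟩`, so only clause (2) of `HonestFar` (= `FlatTubesClosed`) is consumed
when `0 < d.N`; its two antecedents `SeamClockRadii` / `SeamFlatRestrict` are the landed
`…NecksCertifyBargmann.ClockRadii.stub_seamClockRadii` / `…NecksCertifyBargmann.FlatRestrict.stub_seamFlatRestrict`.
Assembly of the landed layers exactly as there: clock shifts/thresholds from `SeamClockRadii`, shell radii
(…Smoothing), `T = max (τ₀', τ₁ + 3, T₀, Y)`, preparation (…Prep), the new hole charts (…HoleChart), the
re-clocked backgrounds `(Λᵢ, cᵢ + Λᵢ(sᵢ∂₀))` (…Helpers) with charts `Glᵢ ∘ inclusion`, the shrunk flat domain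
`{y⁰ > T − 1} ∖ tubes(ρ′)` (`SeamFlatRestrict`); fields and conclusions by the clause theorems (…Transport, …Hole,
…Multi, …Clock, …Exterior).  No definitions, no named facts.
References: DHRT arXiv:2104.08222 §1; O'Neill 1983, Ch. 14.
-/
noncomputable section

open scoped Manifold ContDiff Topology ENNReal
open Filter Set Function Topology Literature.Geometry.Lorentzian

namespace Summit.FinalStateConjecture.FinalStateConjecture.Theorems.GapDecaySuffices.SeamSurgeryPos

set_option linter.dupNamespace false -- the summit and its single problem share the name `FinalStateConjecture`

open Summit.FinalStateConjecture.FinalStateConjecture.Theorems.NecksCertifyTwoCap.Seam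
open Summit.FinalStateConjecture.FinalStateConjecture.Theorems.NecksCertifyBargmann.Seam
  (isOpen_setOf_lt_tubes boostedKerrBackground_add_map_smul_domain
    boostedKerrBackground_add_map_smul_time boostedKerrBackground_add_map_smul_radius
    boostedKerrBackground_add_map_smul_bilin)

set_option maxHeartbeats 800000 in
/-- **Registered stub `stub_seamSurgeryPos`** of line `Sketch` of the crux `GapDecaySuffices`: `SeamSurgeryPos`
(bundles `HonestCore`, `Seamed`, `NeckAtlas` of the skeleton inlined as `let`s, `FlatTubesClosed` written out,
the statement bound as the final `let` so that the header ends in the registered text).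
A core-honest `C⁴` decomposition with relatively closed late flat tubes (`Hf`(2)), at least one hole and a
`NeckAtlas` re-seams into a `C²` decomposition of the same exterior which is core-honest and `Seamed` — the
`0 < d.N` branch of the landed `…Seam.stub_seamSurgery`, fed by the landed `stub_seamClockRadii` /
`stub_seamFlatRestrict` (DHRT arXiv:2104.08222 §1 for the multi-hole picture). [folklore] -/
theorem stub_seamSurgeryPos :
    let HonestCore := fun (𝓢 : Spacetime.{0} 4) (O : Set 𝓢.carrier) (k : ℕ)
        (d : FinalStateDecomposition 𝓢 O k) (R₀ : ℝ) ↦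
      let B := d.background; let t := fun i ↦ (B i).time; let r := fun i ↦ (B i).radius; let Ψ := d.chart;
      (∀ i, Kerr.IsSubextremal (d.mass i) (d.spin i) ∧ 100 * d.mass i ≤ R₀ ∧ 0 < ((d.motion i).1 : E4 ≃L[ℝ] E4) (E4.basisVector 0) 0) ∧
        (∀ i (ϱ τ₂ : ℝ), R₀ ≤ ϱ → d.τ₀ < τ₂ → Ψ i '' {x | d.τ₀ < t i x.1 ∧ t i x.1 < τ₂ ∧ r i x.1 < ϱ} ⊆ 𝓢.metric.causalPast 𝓢.timeOrientation (Ψ i '' (B i).truncTimeSlab ϱ τ₂)) ∧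
        (∀ i (τ' : ℝ) (ϱ : ℝ → ℝ), Continuous ϱ → d.τ₀ < τ' → let A := Ψ i '' {x | τ' ≤ t i x.1 ∧ r i x.1 ≤ ϱ (t i x.1)}; closure A ∩ O ⊆ A) ∧
        (∀ y : d.flatDomain, d.τ₀ < y.1 0 → 𝓢.timeOrientation.IsFutureDirected (mfderiv 𝓘(ℝ, E4) (𝓡 4) d.flatChart y (E4.basisVector 0)))
    let Seamed := fun (𝓢 : Spacetime.{0} 4) (O : Set 𝓢.carrier) (d : FinalStateDecomposition 𝓢 O 2)
        (R : Fin d.N → ℝ → ℝ) (R₀ : ℝ) ↦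
      let B := d.background; let t := fun i ↦ (B i).time; let r := fun i ↦ (B i).radius; let Λ := fun i ↦ ((d.motion i).1 : E4 ≃L[ℝ] E4); let Φ := d.flatChart; let Ψ := d.chart; let ρ := d.excision;
      (∀ i, Monotone (R i) ∧ Continuous (R i) ∧ ∀ s, R₀ + 4 ≤ R i s ∧ R₀ ≤ ρ i s) ∧
        (∀ i, Tendsto (fun τ ↦ 𝓢.truncDeviationCk (B i) (Ψ i) 2 (R i τ) τ) atTop (𝓝 0)) ∧
        supCkENorm (Subtype.val '' {y : d.flatDomain | d.τ₀ ≤ y.1 0}) 0 (𝓢.deviationExtend (Minkowski.backgroundOn d.flatDomain) Φ) ≤ 10⁻¹ ∧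
        (∀ i, supCkENorm (Subtype.val '' {x : (B i).domain | (d.τ₀ ≤ t i x.1 ∨ d.τ₀ ≤ x.1 0) ∧ R₀ ≤ r i x.1 ∧ r i x.1 ≤ R i (t i x.1)}) 0 (𝓢.deviationExtend (B i) (Ψ i)) ≤ ENNReal.ofReal (1 / (10 * ‖(Λ i : E4 →L[ℝ] E4)‖ ^ 2))) ∧
        (∀ i (x : (B i).domain), (d.τ₀ ≤ t i x.1 ∨ d.τ₀ ≤ x.1 0) → R₀ ≤ r i x.1 → r i x.1 ≤ R i (t i x.1) → 𝓢.timeOrientation.IsFutureDirected (mfderiv 𝓘(ℝ, E4) (𝓡 4) (Ψ i) x ((Λ i) (E4.basisVector 0)))) ∧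
        (∀ i (y : E4) (hy : y ∈ (B i).domain), d.τ₀ ≤ y 0 → (∀ j, ρ j (y 0) < r j y) → r i y ≤ R i (t i y) + 1 → ∃ hy' : y ∈ d.flatDomain, Ψ i ⟨y, hy⟩ = Φ ⟨y, hy'⟩) ∧
        (∀ y : d.flatDomain, d.τ₀ ≤ y.1 0 → ∀ j, ρ j (y.1 0) < r j y.1) ∧
        (∀ j (y : E4), d.τ₀ ≤ y 0 → r j y ≤ ρ j (y 0) → r j y + 2 ≤ R j (t j y)) ∧
        (∀ j (y : E4), d.τ₀ ≤ t j y → r j y ≤ R j (t j y) + 2 → t j y ≤ y 0) ∧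
        (∀ j, Ψ j '' {x | d.τ₀ < t j x.1 ∧ R j (t j x.1) + 1 < r j x.1} ⊆ d.radiationZone) ∧
        (∀ τ' : ℝ, d.τ₀ < τ' → closure (Φ '' {y | τ' ≤ y.1 0}) ⊆ Φ '' {y | τ' ≤ y.1 0} ∪ ⋃ j, Ψ j '' {x | τ' ≤ x.1 0 ∧ r j x.1 = ρ j (x.1 0)}) ∧
        (∀ j j' (y : E4), j ≠ j' → (d.τ₀ ≤ y 0 ∨ d.τ₀ ≤ t j y) → r j y ≤ R j (t j y) + 1 → R j' (t j' y) + 1 < r j' y)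
    let NeckAtlas := fun (𝓢 : Spacetime.{0} 4) (O : Set 𝓢.carrier) (d : FinalStateDecomposition 𝓢 O 4)
        (R₀ : ℝ) ↦
      let B := d.background; let t := fun i ↦ (B i).time; let r := fun i ↦ (B i).radius
      let Λ := fun i ↦ ((d.motion i).1 : E4 ≃L[ℝ] E4); let Φ := d.flatChart; let Ψ := d.chart
      let ρ := d.excision
      ∃ (R₁ τ₁ : ℝ) (ρ' Rg : Fin d.N → ℝ → ℝ) (Ψ' : ∀ i, (B i).domain → 𝓢.carrier),
        R₀ ≤ R₁ ∧ d.τ₀ ≤ τ₁ ∧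
        (∀ i, Continuous (ρ' i) ∧ Tendsto (fun s ↦ ρ' i s / s) atTop (𝓝 0) ∧
          ∀ s, R₁ + 1 ≤ ρ' i s ∧ (τ₁ ≤ s → ρ i s + 1 ≤ ρ' i s)) ∧
        (∀ i, Monotone (Rg i) ∧ Continuous (Rg i) ∧ Tendsto (fun s ↦ Rg i s / s) atTop (𝓝 0) ∧
          ∀ s, R₁ + 4 ≤ Rg i s) ∧
        (∀ j (y : E4), τ₁ ≤ y 0 → r j y ≤ ρ' j (y 0) → r j y + 3 ≤ Rg j (t j y)) ∧
        (∀ i, let U : Set (B i).domain := {x | τ₁ < t i x.1 ∧ r i x.1 < Rg i (t i x.1) + 2}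
          ContMDiffOn 𝓘(ℝ, E4) (𝓡 4) ∞ (Ψ' i) U ∧ IsOpenEmbedding (U.restrict (Ψ' i)) ∧
            Ψ' i '' U ⊆ d.charted) ∧
        (∀ i (x : (B i).domain), r i x.1 ≤ R₁ + 1 → Ψ' i x = Ψ i x) ∧
        (∀ i (y : E4) (hy : y ∈ (B i).domain), τ₁ ≤ y 0 → (∀ j, ρ' j (y 0) < r j y) →
          r i y ≤ Rg i (t i y) + 2 → ∃ hy' : y ∈ d.flatDomain, Ψ' i ⟨y, hy⟩ = Φ ⟨y, hy'⟩) ∧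
        (∀ i, Tendsto (fun τ ↦ 𝓢.truncDeviationCk (B i) (Ψ' i) 2 (Rg i τ) τ) atTop (𝓝 0)) ∧
        (∀ i, supCkENorm (Subtype.val '' {x : (B i).domain | τ₁ ≤ t i x.1 ∧ R₁ ≤ r i x.1 ∧
            r i x.1 ≤ Rg i (t i x.1) + 2}) 0 (𝓢.deviationExtend (B i) (Ψ' i)) ≤
          ENNReal.ofReal (1 / (10 * ‖(Λ i : E4 →L[ℝ] E4)‖ ^ 2))) ∧
        (∀ i (x : (B i).domain), τ₁ ≤ t i x.1 → R₁ ≤ r i x.1 → r i x.1 ≤ Rg i (t i x.1) + 2 →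
          𝓢.timeOrientation.IsFutureDirected
            (mfderiv 𝓘(ℝ, E4) (𝓡 4) (Ψ' i) x ((Λ i) (E4.basisVector 0)))) ∧
        (∀ i, Tendsto (Rg i) atTop atTop) ∧
        (∀ j j' (y : E4), j ≠ j' → τ₁ ≤ y 0 → r j y ≤ Rg j (t j y) + 2 → Rg j' (t j' y) + 2 < r j' y) ∧
        (∀ i j, i ≠ j → Disjoint (Ψ' i '' {x | τ₁ < t i x.1 ∧ r i x.1 < Rg i (t i x.1) + 2})
          (Ψ' j '' {x | τ₁ < t j x.1 ∧ r j x.1 < Rg j (t j x.1) + 2})) ∧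
        (∀ i (τ' : ℝ) (ϱ : ℝ → ℝ), Continuous ϱ → τ₁ < τ' → (∀ s, ϱ s < Rg i s + 2) →
          closure (Ψ' i '' {x | τ' ≤ t i x.1 ∧ r i x.1 ≤ ϱ (t i x.1)}) ∩ O ⊆
            Ψ' i '' {x | τ' ≤ t i x.1 ∧ r i x.1 ≤ ϱ (t i x.1)}) ∧
        (∀ (T : ℝ) (Th : Fin d.N → ℝ), τ₁ < T → (∀ j, τ₁ < Th j) →
          (∀ j (y : E4), T < y 0 → r j y ≤ Rg j (t j y) + 2 → Th j < t j y) →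
          O \ (Φ '' {y | T < y.1 0 ∧ ∀ j, ρ' j (y.1 0) < r j y.1} ∪
              ⋃ j, Ψ' j '' {x | Th j < t j x.1 ∧ r j x.1 < Rg j (t j x.1) + 2}) ⊆
            𝓢.metric.causalPast 𝓢.timeOrientation
              (Φ '' {y | y.1 0 = T ∧ ∀ j, ρ' j (y.1 0) < r j y.1} ∪
                ⋃ j, Ψ' j '' {x | t j x.1 = Th j ∧ r j x.1 < Rg j (t j x.1) + 2}))
    let SeamSurgeryPos : Prop :=
      ∀ (X : Type) [TopologicalSpace X] [ChartedSpace E3 X] [IsManifold (𝓡 3) ∞ X] [ConnectedSpace X]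
        (D : InitialDataSet (𝓡 3) X), D ∈ admissibleVacuumData X →
        ∀ 𝒟 : VacuumCauchyDevelopment D, 𝒟.IsMaximal →
        ∀ (O : Set 𝒟.carrier) (d : FinalStateDecomposition 𝒟.toSpacetime O 4) (R₀ : ℝ),
          O = exteriorOf 𝒟.toCauchyDevelopment d.charted →
          HonestCore 𝒟.toSpacetime O 4 d R₀ →
          (∀ τ' : ℝ, d.τ₀ < τ' → closure (d.flatChart '' {y | τ' ≤ y.1 0 ∧ ∀ i, d.excision i (y.1 0) + 1 ≤ (d.background i).radius y.1}) ⊆ d.flatChart '' {y | τ' ≤ y.1 0}) →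
          0 < d.N → NeckAtlas 𝒟.toSpacetime O d R₀ →
          ∃ (d₂ : FinalStateDecomposition 𝒟.toSpacetime O 2) (R : Fin d₂.N → ℝ → ℝ) (R₀' : ℝ),
            O = exteriorOf 𝒟.toCauchyDevelopment d₂.charted ∧ HonestCore 𝒟.toSpacetime O 2 d₂ R₀' ∧
              Seamed 𝒟.toSpacetime O d₂ R R₀'
    SeamSurgeryPos := by
  intro HonestCore Seamed NeckAtlas SeamSurgeryPos X _ _ _ _ D _hD 𝒟 _h𝒟 O d R₀ hO hc hf2 hNpos hA
  have hSCR := NecksCertifyBargmann.ClockRadii.stub_seamClockRadii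
  have hSFR := NecksCertifyBargmann.FlatRestrict.stub_seamFlatRestrict
  obtain ⟨hc1, hc2, -, hc4⟩ := hc
  obtain ⟨R₁, τ₁, ρ', Rg, Ψ', hR₁, hτ₁, hρ', hRg, hA5, hA1, hA2, hA3, hA6, hA7, hA8, hA9, hA10, hA11,
    hA12, hA13⟩ := hA
  dsimp only at hρ' hRg hA5 hA1 hA2 hA3 hA6 hA7 hA8 hA9 hA10 hA11 hA12 hA13
  obtain ⟨s, τ₀', hτ₀', hs0, hS1, hlag, hS8, hS9, hS12, hconv⟩ := hSCR d.N (fun i ↦ (d.motion i).1) (fun i ↦ (d.motion i).2) d.mass d.spin R₁ τ₁ ρ'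
    Rg (fun i ↦ (d.background i).time) (fun i ↦ (d.background i).radius) (fun _ _ ↦ rfl) (fun _ _ ↦ rfl)
    (fun j ↦ (hc1 j).2.2) (fun i ↦ ⟨(hρ' i).1, fun s ↦ ((hρ' i).2.2 s).1⟩) hRg hA5 hA10
  have hb : ∀ i, ∃ b : ℝ → ℝ, ContDiff ℝ ∞ b ∧ Monotone b ∧
      ∀ t, Rg i t + 21 / 20 ≤ b t ∧ b t ≤ Rg i t + 29 / 20 := fun i ↦ by
    obtain ⟨g, hg1, hg2, hg3⟩ := stub_seamSurgery_smoothing (fun t ↦ Rg i t + 29 / 20) (R₁ + 4)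
      (2 / 5) ((hRg i).2.1.add continuous_const) (fun x y h ↦ by linarith [(hRg i).1 h])
      (fun t ↦ by linarith [(hRg i).2.2.2 t]) (tendsto_atTop_add_const_right _ _ (hA9 i))
      (by norm_num)
    exact ⟨g, hg1, hg2, fun t ↦ ⟨by linarith [(hg3 t).2], (hg3 t).1⟩⟩
  choose b hbs hbm hbRg using hb
  obtain ⟨g, hg, hgm, hgid, hgb, hgl, L, hgL, hgs⟩ := exists_squashProfile
  obtain ⟨T₀, hT₀⟩ : ∃ T₀ : ℝ, ∀ τ, T₀ ≤ τ →
      𝒟.toSpacetime.deviationCk (Minkowski.backgroundOn d.flatDomain) d.flatChart 4 τ ≤ 10⁻¹ := by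
    have h10 : (0 : ℝ≥0∞) < 10⁻¹ := by norm_num
    exact eventually_atTop.1 (d.tendsto_deviationCk_flat.eventually (ge_mem_nhds h10))
  obtain ⟨Y, hY⟩ := hconv (τ₁ + 3)
  set T : ℝ := max (max τ₀' (τ₁ + 3)) (max T₀ Y) with hTdef
  obtain ⟨hT1, hT2, hT3, hT4⟩ := stub_seamSurgery_anchorN2 τ₀' (τ₁ + 3) T₀ Y
  have hTτ₀ : d.τ₀ < T := by linarith
  obtain ⟨hR₁4, hdomR, hdomR', hdompos, hdomeq, hcollar, htube, ⟨w₀⟩⟩ :=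
    seam_prep (𝓢 := 𝒟.toSpacetime) hNpos (fun j ↦ (d.motion j).1) (fun j ↦ (d.motion j).2) d.mass
      d.spin d.mass_pos R₁ τ₁ d.τ₀ s (fun j ↦ (hc1 j).2.1.trans hR₁) hs0 hτ₁ Rg
      (fun j ↦ (hRg j).2.2.2) ρ' Ψ' d.flatDomain d.flatChart hA3 hA5 hA10 hlag
  have hpack : ∀ i, ∃ (σ : ℝ → ℝ → ℝ) (G : E4 → E4) (Gl : (d.background i).domain → 𝒟.toSpacetime.carrier),
      (∀ t ρ, ρ ≤ b i t → σ t ρ = ρ) ∧ (∀ t, StrictMono (σ t)) ∧ (∀ t ρ, σ t ρ < b i t + 1 / 2) ∧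
      (∀ t ρ, b i t ≤ ρ → b i t ≤ σ t ρ) ∧ (∀ t t' ρ, t ≤ t' → σ t ρ ≤ σ t' ρ) ∧
      Continuous (fun p : ℝ × ℝ ↦ σ p.1 p.2) ∧ (∀ t ρ, R₁ + 4 < ρ → R₁ + 4 < σ t ρ) ∧
      (∀ t ρ, b i t ≤ ρ → σ t ρ ≤ ρ) ∧
      (∀ y, (d.background i).time (G y) = (d.background i).time y) ∧
      (∀ y, 0 < (d.background i).radius y → (d.background i).radius (G y) = σ ((d.background i).time y) ((d.background i).radius y)) ∧
      (∀ y, 0 < (d.background i).radius y → (d.background i).radius y ≤ b i ((d.background i).time y) → G y = y) ∧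
      InjOn G {y | 0 < (d.background i).radius y} ∧
      (∀ z, R₁ + 4 < (d.background i).radius z → (∃ ϱ, (d.background i).radius z < σ ((d.background i).time z) ϱ) →
        ∃ y, R₁ + 4 < (d.background i).radius y ∧ (d.background i).time y = (d.background i).time z ∧ G y = z) ∧
      ContMDiff 𝓘(ℝ, E4) (𝓡 4) ∞ Gl ∧
      (∀ x : (d.background i).domain, τ₁ + 2 + s i ≤ (d.background i).time x → (d.background i).radius x < b i ((d.background i).time x) →
        Gl x = Ψ' i x) ∧
      (∀ x : (d.background i).domain, τ₁ + 2 + s i ≤ (d.background i).time x → b i ((d.background i).time x) ≤ (d.background i).radius x →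
        ∃ hw : G x ∈ d.flatDomain, Gl x = d.flatChart ⟨G x, hw⟩ ∧ d.τ₀ < G x 0) ∧
      (∀ Tl, τ₁ + 2 + s i ≤ Tl →
        IsOpenEmbedding (Set.restrict {x : (d.background i).domain | Tl < (d.background i).time x} Gl)) ∧
      (∀ x, Gl x ∈ O) := fun i ↦
    exists_holeChart O (d.motion i).1 (d.motion i).2 (d.mass i) (d.spin i) R₁ τ₁ (s i) d.τ₀ hR₁4 (hs0 i) hτ₁
      (hdomR i) (hdompos i) (hdomeq i) (Rg i) (hRg i).1 (hRg i).2.1 (hRg i).2.2.2 (b i) (hbs i)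
      (hbm i) (hbRg i) g L hg hgm hgid hgb hgl hgL hgs (Ψ' i) (hA1 i).1 (hA1 i).2.1
      ((hA1 i).2.2.trans d.charted_subset) d.flatDomain d.flatChart d.isLateChart_flat.contMDiff
      d.isLateChart_flat.isOpenEmbedding (fun w hw ↦ d.isLateChart_flat.image_subset ⟨w, hw, rfl⟩)
      w₀ (fun y ↦ ∀ j, ρ' j (y 0) < (d.background j).radius y) (fun y hy h0 hP hr ↦ hA3 i y hy h0 hP hr)
      (hcollar i)
  choose σ G Gl hσ1 hσ2 hσ3 hσ4 hσ5 hσ6 hσ7 hσ8 hG1 hG2 hG3 hG5 hG7 hGl1 hGl2 hGl3 hGl4 hGl5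
    using hpack
  set motion₂ : Fin d.N → lorentzGroup × E4 := fun i ↦
    ((d.motion i).1, (d.motion i).2 + ((d.motion i).1 : E4 ≃L[ℝ] E4) (s i • E4.basisVector 0)) with hmotion₂
  set B₂ : Fin d.N → ModelBackground := fun i ↦
    boostedKerrBackground (motion₂ i).1 (motion₂ i).2 (d.mass i) (d.spin i) with hB₂
  have hdom₂ : ∀ i, (B₂ i).domain = (d.background i).domain := fun i ↦
    boostedKerrBackground_add_map_smul_domain (d.motion i).1 (d.motion i).2 (s i) (d.mass i) (d.spin i)
  have htime₂ : ∀ i y, (B₂ i).time y = (d.background i).time y - s i := fun i y ↦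
    boostedKerrBackground_add_map_smul_time (d.motion i).1 (d.motion i).2 (s i) (d.mass i) (d.spin i) y
  have hrad₂ : ∀ i y, (B₂ i).radius y = (d.background i).radius y := fun i y ↦
    congrFun (boostedKerrBackground_add_map_smul_radius (d.motion i).1 (d.motion i).2 (s i) (d.mass i) (d.spin i)) y
  have hbil₂ : ∀ i y, (B₂ i).bilin y = (d.background i).bilin y := fun i y ↦
    congrFun (boostedKerrBackground_add_map_smul_bilin (d.motion i).1 (d.motion i).2 (s i) (d.mass i) (d.spin i)) y
  have hle₂ : ∀ i, (B₂ i).domain ≤ (d.background i).domain := fun i ↦ (hdom₂ i).le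
  set chart₂ : ∀ i, (B₂ i).domain → 𝒟.toSpacetime.carrier := fun i ↦
    Gl i ∘ TopologicalSpace.Opens.inclusion (hle₂ i) with hchart₂
  set U₂ : TopologicalSpace.Opens E4 := ⟨{y | T - 1 < y 0 ∧ ∀ i, ρ' i (y 0) < (d.background i).radius y},
    isOpen_setOf_lt_tubes (T - 1) ρ' (fun i ↦ (hρ' i).1) d.spin (fun i ↦ (d.motion i).1)
      (fun i ↦ (d.motion i).2)⟩ with hU₂
  have hU₂le : U₂ ≤ d.flatDomain := fun y hy ↦ by
    obtain ⟨hy0, hyr⟩ := hy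
    refine d.setOf_lt_excision_subset_flatDomain ⟨by linarith, fun i ↦ ?_⟩
    have h1 := ((hρ' i).2.2 (y 0)).2 (by linarith)
    have h2 := hyr i
    show d.excision i (y 0) < (d.background i).radius y
    linarith
  obtain ⟨hLC₂, hmf₂, -, hsup₂, hdk₂⟩ := hSFR 𝒟.toSpacetime O d.flatDomain U₂ hU₂le d.τ₀ T d.flatChart hTτ₀.le
    d.isLateChart_flat
  have hset₂ : ∀ i, ((d.background i).domain : Set E4) ⊆ (B₂ i).domain := fun i y hy ↦ by
    rw [hdom₂ i]; exact hy
  have hUmk : ∀ y : E4, T - 1 < y 0 → (∀ j, ρ' j (y 0) < (d.background j).radius y) → y ∈ U₂ :=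
    fun y h1 h2 ↦ ⟨h1, h2⟩
  have hUmem : ∀ y : E4, y ∈ U₂ → ∀ j, ρ' j (y 0) < (d.background j).radius y := fun y hy ↦ hy.2
  -- consequences of the thresholds
  obtain ⟨hY', hYle, hcompat⟩ := thresholds₂ (fun j ↦ (d.motion j).1) (fun j ↦ (d.motion j).2) d.mass
    d.spin τ₁ Y T hT4 s Rg hY
  have horth : ∀ j, 0 < (((d.motion j).1 : E4 ≃L[ℝ] E4) (E4.basisVector 0)) 0 := fun j ↦ (hc1 j).2.2
  have hHc2' : ∀ i (ϱ τ₂ : ℝ), R₁ ≤ ϱ → d.τ₀ < τ₂ →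
      d.chart i '' {x | d.τ₀ < (d.background i).time x ∧ (d.background i).time x < τ₂ ∧
        (d.background i).radius x < ϱ} ⊆
      𝒟.toSpacetime.metric.causalPast 𝒟.toSpacetime.timeOrientation
        (d.chart i '' (d.background i).truncTimeSlab ϱ τ₂) := fun i ϱ τ₂ hϱ hτ₂ ↦
    hc2 i ϱ τ₂ (hR₁.trans hϱ) hτ₂
  have hPQ : ∀ y : E4, τ₁ ≤ y 0 → (∀ j, ρ' j (y 0) < (d.background j).radius y) →
      ∀ j, d.excision j (y 0) + 1 ≤ (d.background j).radius y := fun y hy hP j ↦ by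
    have := ((hρ' j).2.2 (y 0)).2 hy; have := hP j; linarith
  -- structure fields
  have hF1 : ∀ i, 𝒟.toSpacetime.IsLateChart (B₂ i) O T (chart₂ i) := fun i ↦
    isLateChart₂ (d.motion i).1 (d.motion i).2 (d.mass i) (d.spin i) τ₁ (s i) T hT2 (Gl i) (hGl1 i)
      (hGl4 i) O (hGl5 i) (B₂ i) (hle₂ i) (htime₂ i)
  have hdev := fun i ↦ deviation_clauses (𝓢 := 𝒟.toSpacetime) (d.motion i).1 (d.motion i).2
    (d.mass i) (d.spin i) R₁ τ₁ (s i) T Y (hs0 i) hT2 hT4 (Rg i) (hA9 i) (b i) (hbs i).continuous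
    (fun t ↦ (hbRg i t).1) (Ψ' i) (Gl i) (hGl1 i) (hGl2 i) (hA6 i) (hA7 i) (hA8 i)
    (fun y h1 h2 ↦ hY i y h1 h2) (B₂ i) (hle₂ i) (hset₂ i) (htime₂ i) (hrad₂ i) (hbil₂ i)
  have hF2 : ∀ i (R' : ℝ), Tendsto (fun τ ↦ 𝒟.toSpacetime.truncDeviationCk (B₂ i) (chart₂ i) 2 R' τ)
      atTop (𝓝 0) := fun i R' ↦ (hdev i).1 R'
  have hF3 : ∀ R' : ℝ, ∃ τ₂ : ℝ, Pairwise (Function.onFun Disjoint fun i ↦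
      chart₂ i '' (B₂ i).truncLateRegion τ₂ R') :=
    pairwiseDisjoint₂ (fun j ↦ (d.motion j).1) (fun j ↦ (d.motion j).2) d.mass d.spin τ₁ T s hs0 hT2
      Rg hA9 b (fun j t ↦ (hbRg j t).1) Ψ' Gl hGl2 hA11 B₂ hle₂ htime₂ hrad₂
  have hF5 : {x : E4 | T < x 0 ∧ ∀ i, ρ' i (x 0) <
      Kerr.radius (d.spin i) (poincareInv (motion₂ i).1 (motion₂ i).2 x)} ⊆ U₂ := by
    intro x hx
    refine ⟨by linarith [hx.1], fun i ↦ ?_⟩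
    have h := hx.2 i
    rw [show Kerr.radius (d.spin i) (poincareInv (motion₂ i).1 (motion₂ i).2 x) = (B₂ i).radius x
      from rfl, hrad₂] at h
    exact h
  have hF7 : Tendsto (fun τ ↦ 𝒟.toSpacetime.deviationCk (Minkowski.backgroundOn U₂)
      (d.flatChart ∘ TopologicalSpace.Opens.inclusion hU₂le) 2 τ) atTop (𝓝 0) :=
    tendsto_of_tendsto_of_tendsto_of_le_of_le tendsto_const_nhds d.tendsto_deviationCk_flat
      (fun _ ↦ zero_le) fun τ ↦ (hdk₂ 2 τ).trans
        (𝒟.toSpacetime.deviationCk_mono _ _ (by norm_num) τ)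
  have hF8 := covering₂ (𝓢 := 𝒟.toSpacetime) (fun j ↦ (d.motion j).1) (fun j ↦ (d.motion j).2)
    d.mass d.spin R₁ τ₁ d.τ₀ T s hs0 hτ₁ hT2 hdomeq Rg (fun j ↦ (hRg j).1) (fun j ↦ (hRg j).2.1)
    (fun j ↦ (hRg j).2.2.2) b hbm hbRg d.chart Ψ' Gl (fun j ↦ (hA1 j).1) hA2 hA8 hHc2' d.flatDomain
    d.flatChart (fun y ↦ ∀ j, ρ' j (y 0) < (d.background j).radius y) hA3 hcollar hGl2 horth hlag
    htube hY' O (hA13 T (fun j ↦ τ₁ + 5 / 2 + s j) (by linarith) (fun j ↦ by linarith [hs0 j])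
      (hcompat T le_rfl)) B₂ hle₂ hset₂ htime₂ U₂ hU₂le hUmk
  -- conclusions, stated for the components of `d₂`
  have hHc2new := fun i ↦ honestCore₂_two (𝓢 := 𝒟.toSpacetime) (d.motion i).1 (d.motion i).2
    (d.mass i) (d.spin i) R₁ τ₁ (s i) d.τ₀ T hR₁4 (hs0 i) hτ₁ hT2 (hdomR i) (hdompos i) (hdomeq i)
    (Rg i) (hRg i).1 (hRg i).2.1 (hRg i).2.2.2 (b i) (hbm i) (hbRg i) (σ i) (G i) (hσ2 i) (hσ3 i)
    (hσ4 i) (hσ5 i) (hσ8 i) (hG1 i) (hG2 i) (hG3 i) (hG7 i) (d.chart i) (Ψ' i) (Gl i) (hA1 i).1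
    (hA2 i) (hA8 i) (hHc2' i) d.flatDomain d.flatChart
    (fun y ↦ ∀ j, ρ' j (y 0) < (d.background j).radius y) (hA3 i) (hcollar i) (hGl2 i) (hGl3 i)
    (B₂ i) (hle₂ i) (hset₂ i) (htime₂ i) (hrad₂ i)
  have hHc3new := fun i ↦ honestCore₂_three (𝓢 := 𝒟.toSpacetime) (d.motion i).1 (d.motion i).2
    (d.mass i) (d.spin i) R₁ τ₁ (s i) d.τ₀ T (hs0 i) hτ₁ hT2 (hdomR i) (hdompos i) (Rg i)
    (hRg i).2.2.2 (b i) (hbs i).continuous (hbRg i) (σ i) (G i) (hσ1 i) (hσ2 i) (hσ3 i) (hσ4 i)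
    (hσ6 i) (hG1 i) (hG2 i) (hG3 i) (hG7 i) (Ψ' i) (Gl i) O (hA12 i) d.flatDomain d.flatChart
    (fun y ↦ ∀ j, ρ' j (y 0) < (d.background j).radius y)
    (fun y ↦ ∀ j, d.excision j (y 0) + 1 ≤ (d.background j).radius y)
    d.isLateChart_flat.isOpenEmbedding hf2 hPQ (hA3 i) (hcollar i) (hlag i) (hGl2 i) (hGl3 i)
    (B₂ i) (hle₂ i) (hset₂ i) (htime₂ i) (hrad₂ i)
  -- HonestCore (4)
  have hHc4new : ∀ y : U₂, T < y.1 0 → 𝒟.toSpacetime.timeOrientation.IsFutureDirected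
      (mfderiv 𝓘(ℝ, E4) (𝓡 4) (d.flatChart ∘ TopologicalSpace.Opens.inclusion hU₂le) y
        (E4.basisVector 0)) := by
    intro y hy
    rw [hmf₂ y]
    exact hc4 _ (by have h := y.2.1; show d.τ₀ < y.1 0; linarith)
  -- S3
  have hS3new : supCkENorm (Subtype.val '' {y : U₂ | T ≤ y.1 0}) 0
      (𝒟.toSpacetime.deviationExtend (Minkowski.backgroundOn U₂)
        (d.flatChart ∘ TopologicalSpace.Opens.inclusion hU₂le)) ≤ 10⁻¹ :=
    stub_seamSurgery_flatLateSup 𝒟.toSpacetime U₂ _ 4 T 10⁻¹ fun τ hτ ↦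
      (hdk₂ 4 τ).trans (hT₀ τ (hT3.trans hτ))
  have hS6new := fun i ↦ seamed₂_six (𝓢 := 𝒟.toSpacetime) (d.motion i).1 (d.motion i).2 (d.mass i)
    (d.spin i) τ₁ (s i) T hT2 (Rg i) (b i) (fun t ↦ (hbRg i t).1) (Ψ' i) (Gl i) d.flatDomain
    d.flatChart (fun y ↦ ∀ j, ρ' j (y 0) < (d.background j).radius y)
    (fun y ↦ ∀ j, ρ' j (y 0) < (B₂ j).radius y)
    (fun y hP j ↦ by have h := hP j; rwa [hrad₂] at h) (hA3 i) (hYle i) (hGl2 i) (B₂ i) (hle₂ i)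
    (htime₂ i) (hrad₂ i) U₂ hU₂le hUmk
  obtain ⟨hS7new, hS8new, hS9new, hS12new⟩ := seamed₂_clock (fun j ↦ (d.motion j).1)
    (fun j ↦ (d.motion j).2) d.mass d.spin τ₀' T hT1 s ρ' Rg hS8 hS9 hS12 B₂ htime₂ hrad₂ U₂ hUmem
  have hS10new := fun i ↦ seamed₂_ten (𝓢 := 𝒟.toSpacetime) (d.motion i).1 (d.motion i).2 (d.mass i)
    (d.spin i) R₁ τ₁ (s i) d.τ₀ T (hs0 i) hT2 (hdomR i) (hdompos i) (Rg i) (hRg i).2.2.2 (b i)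
    (hbRg i) (σ i) (G i) (hσ3 i) (hσ4 i) (hG1 i) (hG2 i) (Ψ' i) (Gl i) d.flatDomain d.flatChart
    (fun y ↦ ∀ j, ρ' j (y 0) < (d.background j).radius y) (hA3 i) (hcollar i) (hlag i) (hGl2 i)
    (hGl3 i) (B₂ i) (hle₂ i) (htime₂ i) (hrad₂ i) U₂ hU₂le hUmk
  have hS11new := seamed₂_eleven (𝓢 := 𝒟.toSpacetime) (fun j ↦ (d.motion j).1)
    (fun j ↦ (d.motion j).2) d.mass d.spin R₁ τ₁ d.τ₀ T s hs0 hτ₁ hT2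
    (fun j y hy ↦ hdomR' j y (by linarith)) Rg (fun j ↦ (hRg j).2.1) b (fun j t ↦ (hbRg j t).1) ρ'
    (fun j ↦ (hρ' j).1) (fun j t ↦ ((hρ' j).2.2 t).1) Ψ' Gl (fun j ↦ (hA1 j).1) d.flatDomain
    d.flatChart (fun y ↦ ∀ j, d.excision j (y 0) + 1 ≤ (d.background j).radius y)
    d.isLateChart_flat.isOpenEmbedding hf2 hPQ hA3 hA5 hY' hGl2 B₂ hle₂ hset₂ hrad₂ U₂ hU₂le hUmk
    hUmem
  -- `O = exteriorOf 𝒟 d₂.charted`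
  have hreach := reach₂ (𝓢 := 𝒟.toSpacetime) (fun j ↦ (d.motion j).1) (fun j ↦ (d.motion j).2)
    d.mass d.spin R₁ τ₁ d.τ₀ T s hs0 hτ₁ hT2 hdomeq Rg (fun j ↦ (hRg j).1) (fun j ↦ (hRg j).2.1)
    (fun j ↦ (hRg j).2.2.2) b hbRg d.chart Ψ' Gl (fun j ↦ (hA1 j).1) hA2 hA8 hHc2' d.flatDomain
    d.flatChart (fun y ↦ ∀ j, ρ' j (y 0) < (d.background j).radius y) hA3 hcollar hGl2 hlag O
    (hA13 (T + 1) (fun j ↦ τ₁ + 5 / 2 + s j) (by linarith) (fun j ↦ by linarith [hs0 j])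
      (hcompat (T + 1) (by linarith))) B₂ hle₂ hset₂ htime₂ U₂ hU₂le hUmk
  have hext := exterior_congr _ d.charted _ O hO d.charted_subset
    (union_subset hLC₂.image_subset (iUnion_subset fun i ↦ (hF1 i).image_subset)) hreach
  let d₂ : FinalStateDecomposition 𝒟.toSpacetime O 2 :=
    { N := d.N
      mass := d.mass
      spin := d.spin
      mass_pos := d.mass_pos
      abs_spin_le_mass := d.abs_spin_le_mass
      motion := motion₂
      τ₀ := T
      chart := chart₂
      isLateChart := hF1
      tendsto_truncDeviationCk := hF2
      exists_pairwise_disjoint := hF3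
      excision := ρ'
      tendsto_excision_div := fun i ↦ (hρ' i).2.1
      flatDomain := U₂
      setOf_lt_excision_subset_flatDomain := hF5
      flatChart := d.flatChart ∘ TopologicalSpace.Opens.inclusion hU₂le
      isLateChart_flat := hLC₂
      tendsto_deviationCk_flat := hF7
      diff_subset_causalPast := hF8 }
  refine ⟨d₂, fun i τ ↦ Rg i (τ + s i), R₁, hext, ?_, ?_⟩
  · exact ⟨fun i ↦ ⟨(hc1 i).1, (hc1 i).2.1.trans hR₁, (hc1 i).2.2⟩, hHc2new, hHc3new, hHc4new⟩
  · exact ⟨fun i ↦ hS1 i, fun i ↦ (hdev i).2.1, hS3new, fun i ↦ (hdev i).2.2.1,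
      fun i x hx h1 h2 ↦ (hdev i).2.2.2 x hx h1 h2, hS6new, hS7new, hS8new, hS9new, hS10new,
      hS11new, hS12new⟩

end Summit.FinalStateConjecture.FinalStateConjecture.Theorems.GapDecaySuffices.SeamSurgeryPos

end
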